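import Mathlib

/-!
# Matrix cross interpolation (CUR / skeleton decomposition)

Let `A` be an `m × n` matrix over a commutative ring and let `r : ι → m`, `c : ι → n` pick out
`χ̃ = card ι` pivot rows and pivot columns, with slices `P = A[r, c]` (the pivot matrix),
`C = A[:, c]`, `R = A[r, :]`.  The matrix CROSS INTERPOLATION of `A` on these pivots is
`Ã = C P⁻¹ R` [NunezFernandezEtAl2025, §3.1] (the "CI formula"; classical under the names
skeleton / pseudo-skeleton / CUR decomposition).  It is the linear-algebra kernel of tensor cross
interpolation (TCI): every local update of a tensor train in TCI is a matrix cross interpolation of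
an unfolding of the tensor.

This file formalises the exact (non-asymptotic) algebra of the CI formula:

* `crossInterp A r c` — the matrix `C P⁻¹ R` (with Mathlib's `Matrix.inv`, so that it is the junk
  value `C ⬝ 0 ⬝ R = 0` when `P` is singular; every statement below assumes `IsUnit P.det`)
  [NunezFernandezEtAl2025, §3.1];
* `submatrix_crossInterp_pivotRows`, `submatrix_crossInterp_pivotCols`,
  `crossInterp_apply_pivotRow`, `crossInterp_apply_pivotCol` — the INTERPOLATION property: `Ã`
  reproduces the pivot rows and the pivot columns of `A` exactly, `Ã[r, :] = R`, `Ã[:, c] = C`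
  [NunezFernandezEtAl2025, §3.1 property (ii)];
* `crossInterp_fromBlocks`, `fromBlocks_sub_crossInterp` — in block form, with the pivots moved
  to the leading block `A₁₁`, `Ã = [[A₁₁, A₁₂], [A₂₁, A₂₁ A₁₁⁻¹ A₁₂]]` and the ERROR of the
  interpolation is the Schur complement, `A - Ã = [[0, 0], [0, A₂₂ - A₂₁ A₁₁⁻¹ A₁₂]]`
  [NunezFernandezEtAl2025, §3.2.3; HornJohnson2013, §0.8.5 (0.8.5.3)];
* `rank_crossInterp_le` — `rank Ã ≤ χ̃` [NunezFernandezEtAl2025, §3.1];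
  `card_le_rank_of_isUnit_det_submatrix` — a matrix with a nonsingular `χ̃ × χ̃` submatrix has
  rank `≥ χ̃` [HornJohnson2013, §0.4.4 (d)];
* `crossInterp_eq_self_of_rank_eq`, `crossInterp_eq_self_iff_rank_eq` — EXACTNESS: over a field,
  if `rank A = χ̃` (the number of pivots equals the rank) then `Ã = A`, and conversely
  [NunezFernandezEtAl2025, §3.1 property (i)]; in block form, `rank_fromBlocks_eq_card_iff`:
  `rank [[A₁₁, A₁₂], [A₂₁, A₂₂]] = card ι ↔ A₂₂ = A₂₁ A₁₁⁻¹ A₁₂` for nonsingular `A₁₁`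
  [HornJohnson2013, §0.8.5 (b)];
* `rank_fromBlocks_eq_card_add_rank_schur` — Guttman rank additivity
  `rank [[A₁₁, A₁₂], [A₂₁, A₂₂]] = card ι + rank (A₂₂ - A₂₁ A₁₁⁻¹ A₁₂)` for nonsingular `A₁₁`
  [HornJohnson2013, §0.8.5 (b)].

Already in Mathlib and therefore not restated: the block `LDU` factorisation
`Matrix.fromBlocks_eq_of_invertible₁₁` and the Schur determinant identity `Matrix.det_fromBlocks₁₁`
[NunezFernandezEtAl2025, §3.2.1; HornJohnson2013, §0.8.5 (0.8.5.1)–(0.8.5.3)].  Not formalised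
here: anything approximate or algorithmic — the maximum-volume error bound for the
choice of pivots, pivot-search heuristics (full / rook / block-rook search), the partial
rank-revealing LU reformulation and its update formulas [NunezFernandezEtAl2025, §§3.3–3.5], and
the tensor-train level of TCI [NunezFernandezEtAl2025, §4].

References: Y. Núñez Fernández, M. K. Ritter, M. Jeannin, J.-W. Li, T. Kloss, T. Louvet,
S. Terasaki, O. Parcollet, J. von Delft, H. Shinaoka, X. Waintal, *Learning tensor networks with
tensor cross interpolation: new algorithms and libraries*, SciPost Phys. 18 (2025) 104,
arXiv:2407.02454 (`NunezFernandezEtAl2025`); R. A. Horn, C. R. Johnson, *Matrix Analysis*, 2nd ed.,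
Cambridge University Press 2013 (`HornJohnson2013`).

AI-produced formalisation (H21 engines group, seat eng-quad-2, 2026-08-21); no facts, no axioms
beyond Mathlib's, no `sorry`.
-/

open Matrix

namespace Literature.LinearAlgebra.Matrix

section CommRing

variable {K : Type*} [CommRing K] {m n ι : Type*} [Fintype ι] [DecidableEq ι]

/-- The CROSS INTERPOLATION of `A` on the pivot rows `r : ι → m` and pivot columns `c : ι → n`:
`Ã = C P⁻¹ R` with `C = A[:, c] = A.submatrix id c`, `P = A[r, c] = A.submatrix r c` (the pivot
matrix) and `R = A[r, :] = A.submatrix r id`.  Here `P⁻¹` is Mathlib's `Matrix.inv`, which is the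
genuine inverse when `IsUnit P.det` and `0` otherwise.
[cite: NunezFernandezEtAl2025, §3.1] -/
noncomputable def crossInterp (A : Matrix m n K) (r : ι → m) (c : ι → n) : Matrix m n K :=
  A.submatrix id c * (A.submatrix r c)⁻¹ * A.submatrix r id

/-- Unfolding lemma: `crossInterp A r c = A[:, c] (A[r, c])⁻¹ A[r, :]`.
[cite: NunezFernandezEtAl2025, §3.1] -/
theorem crossInterp_def (A : Matrix m n K) (r : ι → m) (c : ι → n) :
    crossInterp A r c = A.submatrix id c * (A.submatrix r c)⁻¹ * A.submatrix r id := rfl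

/-! ### Interpolation: the pivot rows and columns are reproduced exactly -/

/-- The cross interpolation reproduces the pivot rows: `Ã[r, :] = A[r, :]`, because
`A[r, c] P⁻¹ = 1`.
[cite: NunezFernandezEtAl2025, §3.1 property (ii)] -/
theorem submatrix_crossInterp_pivotRows (A : Matrix m n K) {r : ι → m} {c : ι → n}
    (hP : IsUnit (A.submatrix r c).det) :
    (crossInterp A r c).submatrix r id = A.submatrix r id := by
  unfold crossInterp
  rw [Matrix.submatrix_mul _ _ r id id Function.bijective_id,
    Matrix.submatrix_mul _ _ r id id Function.bijective_id]
  simp only [Matrix.submatrix_submatrix, Matrix.submatrix_id_id, Function.comp_id,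
    Function.id_comp]
  rw [Matrix.mul_nonsing_inv _ hP, Matrix.one_mul]

/-- The cross interpolation reproduces the pivot columns: `Ã[:, c] = A[:, c]`, because
`P⁻¹ A[r, c] = 1`.
[cite: NunezFernandezEtAl2025, §3.1 property (ii)] -/
theorem submatrix_crossInterp_pivotCols (A : Matrix m n K) {r : ι → m} {c : ι → n}
    (hP : IsUnit (A.submatrix r c).det) :
    (crossInterp A r c).submatrix id c = A.submatrix id c := by
  unfold crossInterp
  rw [Matrix.mul_assoc, Matrix.submatrix_mul _ _ id id c Function.bijective_id,
    Matrix.submatrix_mul _ _ id id c Function.bijective_id]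
  simp only [Matrix.submatrix_submatrix, Matrix.submatrix_id_id, Function.comp_id,
    Function.id_comp]
  rw [Matrix.nonsing_inv_mul _ hP, Matrix.mul_one]

/-- Entrywise form of `submatrix_crossInterp_pivotRows`: `Ã (r i) j = A (r i) j`.
[cite: NunezFernandezEtAl2025, §3.1 property (ii)] -/
theorem crossInterp_apply_pivotRow (A : Matrix m n K) {r : ι → m} {c : ι → n}
    (hP : IsUnit (A.submatrix r c).det) (i : ι) (j : n) :
    crossInterp A r c (r i) j = A (r i) j := by
  simpa using congr_fun (congr_fun (submatrix_crossInterp_pivotRows A hP) i) j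

/-- Entrywise form of `submatrix_crossInterp_pivotCols`: `Ã i (c j) = A i (c j)`.
[cite: NunezFernandezEtAl2025, §3.1 property (ii)] -/
theorem crossInterp_apply_pivotCol (A : Matrix m n K) {r : ι → m} {c : ι → n}
    (hP : IsUnit (A.submatrix r c).det) (i : m) (j : ι) :
    crossInterp A r c i (c j) = A i (c j) := by
  simpa using congr_fun (congr_fun (submatrix_crossInterp_pivotCols A hP) i) j

/-! ### Block form: the error of the interpolation is the Schur complement -/

section Block

variable {α : Type*} {m' n' : Type*}

omit [Fintype ι] [DecidableEq ι] in
/-- The leading block of a block matrix as a submatrix. [folklore] -/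
@[simp] private theorem fromBlocks_submatrix_inl_inl (A₁₁ : Matrix ι ι α) (A₁₂ : Matrix ι n' α)
    (A₂₁ : Matrix m' ι α) (A₂₂ : Matrix m' n' α) :
    (fromBlocks A₁₁ A₁₂ A₂₁ A₂₂).submatrix Sum.inl Sum.inl = A₁₁ := by
  ext i j
  simp

omit [Fintype ι] [DecidableEq ι] in
/-- The leading block column of a block matrix as a submatrix. [folklore] -/
@[simp] private theorem fromBlocks_submatrix_id_inl (A₁₁ : Matrix ι ι α) (A₁₂ : Matrix ι n' α)
    (A₂₁ : Matrix m' ι α) (A₂₂ : Matrix m' n' α) :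
    (fromBlocks A₁₁ A₁₂ A₂₁ A₂₂).submatrix id Sum.inl = fromRows A₁₁ A₂₁ := by
  ext (i | i) j <;> simp

omit [Fintype ι] [DecidableEq ι] in
/-- The leading block row of a block matrix as a submatrix. [folklore] -/
@[simp] private theorem fromBlocks_submatrix_inl_id (A₁₁ : Matrix ι ι α) (A₁₂ : Matrix ι n' α)
    (A₂₁ : Matrix m' ι α) (A₂₂ : Matrix m' n' α) :
    (fromBlocks A₁₁ A₁₂ A₂₁ A₂₂).submatrix Sum.inl id = fromCols A₁₁ A₁₂ := by
  ext i (j | j) <;> simp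

/-- BLOCK FORM of the cross interpolation.  With the pivots moved to the leading block, i.e. for
`A = [[A₁₁, A₁₂], [A₂₁, A₂₂]]` with nonsingular pivot matrix `P = A₁₁`,
`Ã = [[A₁₁], [A₂₁]] A₁₁⁻¹ [[A₁₁, A₁₂]] = [[A₁₁, A₁₂], [A₂₁, A₂₁ A₁₁⁻¹ A₁₂]]`.
[cite: NunezFernandezEtAl2025, §3.2.3] -/
theorem crossInterp_fromBlocks (A₁₁ : Matrix ι ι K) (A₁₂ : Matrix ι n' K) (A₂₁ : Matrix m' ι K)
    (A₂₂ : Matrix m' n' K) (h : IsUnit A₁₁.det) :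
    crossInterp (fromBlocks A₁₁ A₁₂ A₂₁ A₂₂) Sum.inl Sum.inl =
      fromBlocks A₁₁ A₁₂ A₂₁ (A₂₁ * A₁₁⁻¹ * A₁₂) := by
  rw [crossInterp, fromBlocks_submatrix_inl_inl, fromBlocks_submatrix_id_inl,
    fromBlocks_submatrix_inl_id, Matrix.fromRows_mul, Matrix.mul_nonsing_inv _ h,
    Matrix.fromRows_mul_fromCols, Matrix.one_mul, Matrix.one_mul,
    Matrix.nonsing_inv_mul_cancel_right _ _ h]

/-- The ERROR of the cross interpolation is the Schur complement of the pivot matrix: in block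
form `A - Ã = [[0, 0], [0, [A/A₁₁]]]` with `[A/A₁₁] = A₂₂ - A₂₁ A₁₁⁻¹ A₁₂`; in particular the
interpolation is exact on the `11`-, `12`- and `21`-blocks.
[cite: NunezFernandezEtAl2025, §3.2.3][cite: HornJohnson2013, §0.8.5 (0.8.5.3)] -/
theorem fromBlocks_sub_crossInterp (A₁₁ : Matrix ι ι K) (A₁₂ : Matrix ι n' K)
    (A₂₁ : Matrix m' ι K) (A₂₂ : Matrix m' n' K) (h : IsUnit A₁₁.det) :
    fromBlocks A₁₁ A₁₂ A₂₁ A₂₂ - crossInterp (fromBlocks A₁₁ A₁₂ A₂₁ A₂₂) Sum.inl Sum.inl =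
      fromBlocks 0 0 0 (A₂₂ - A₂₁ * A₁₁⁻¹ * A₁₂) := by
  rw [crossInterp_fromBlocks _ _ _ _ h]
  ext (i | i) (j | j) <;> simp

end Block

end CommRing

/-! ### Rank bounds -/

section Rank

variable {K : Type*} [CommRing K] [StrongRankCondition K] {m n ι : Type*} [Fintype n]
  [Fintype ι] [DecidableEq ι]

/-- The cross interpolation on `χ̃ = card ι` pivots has rank at most `χ̃` (it factors through
`K^ι`): the CI formula is a rank-`χ̃` approximation.
[cite: NunezFernandezEtAl2025, §3.1] -/
theorem rank_crossInterp_le (A : Matrix m n K) (r : ι → m) (c : ι → n) :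
    (crossInterp A r c).rank ≤ Fintype.card ι :=
  (Matrix.rank_mul_le_left _ _).trans (Matrix.rank_le_card_width _)

/-- A matrix with a nonsingular `χ̃ × χ̃` submatrix has rank at least `χ̃` (the easy half of the
characterisation of the rank as the size of a largest nonsingular submatrix).
[cite: HornJohnson2013, §0.4.4 (d)] -/
theorem card_le_rank_of_isUnit_det_submatrix (A : Matrix m n K) {r : ι → m} {c : ι → n}
    (hP : IsUnit (A.submatrix r c).det) : Fintype.card ι ≤ A.rank :=
  calc Fintype.card ι = (A.submatrix r c).rank :=
      (Matrix.rank_of_isUnit _ ((Matrix.isUnit_iff_isUnit_det _).mpr hP)).symm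
    _ ≤ A.rank := Matrix.rank_submatrix_le A r c

end Rank

/-! ### Exactness when the number of pivots equals the rank -/

section Field

variable {K : Type*} [Field K] {m n ι : Type*} [Fintype n] [Fintype ι] [DecidableEq ι]

/-- EXACTNESS of the cross interpolation: if the pivot matrix `P = A[r, c]` is nonsingular and
the number `χ̃ = card ι` of pivots equals `rank A`, then `C P⁻¹ R = A`.  (Proof: the `χ̃` pivot
columns are linearly independent, hence span the column space of `A`; so `A = C X` for some `X`,
and restricting to the pivot rows gives `R = P X`, i.e. `X = P⁻¹ R`.)
[cite: NunezFernandezEtAl2025, §3.1 property (i)][cite: HornJohnson2013, §0.8.5 (b)] -/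
theorem crossInterp_eq_self_of_rank_eq (A : Matrix m n K) {r : ι → m} {c : ι → n}
    (hP : IsUnit (A.submatrix r c).det) (hrank : A.rank = Fintype.card ι) :
    crossInterp A r c = A := by
  classical
  -- the column space of `C = A[:, c]` is contained in that of `A` …
  have hle : LinearMap.range (A.submatrix id c).mulVecLin ≤ LinearMap.range A.mulVecLin := by
    have hCA : A.submatrix id c = A * (1 : Matrix n n K).submatrix id c := by
      simpa using (Matrix.mul_submatrix_one (Equiv.refl n) c A).symm
    rw [hCA, Matrix.mulVecLin_mul]
    exact LinearMap.range_comp_le_range _ _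
  -- … and has dimension at least `card ι = rank A`, so the two column spaces coincide;
  have hCrank : Fintype.card ι ≤ (A.submatrix id c).rank := by
    have h : ((A.submatrix id c).submatrix r id).rank ≤ (A.submatrix id c).rank :=
      Matrix.rank_submatrix_le _ r id
    have h' : (A.submatrix id c).submatrix r id = A.submatrix r c := by
      simp only [Matrix.submatrix_submatrix, Function.comp_id, Function.id_comp]
    rw [h', Matrix.rank_of_isUnit _ ((Matrix.isUnit_iff_isUnit_det _).mpr hP)] at h
    exact h
  have heq : LinearMap.range (A.submatrix id c).mulVecLin = LinearMap.range A.mulVecLin :=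
    Submodule.eq_of_le_of_finrank_le hle (by
      change A.rank ≤ (A.submatrix id c).rank
      exact hrank.trans_le hCrank)
  -- hence every column of `A` is `C xⱼ` for some `xⱼ`, i.e. `A = C X`;
  have hcol : ∀ j : n, ∃ x : ι → K, A.submatrix id c *ᵥ x = fun i => A i j := by
    intro j
    have hj : (fun i => A i j) ∈ LinearMap.range A.mulVecLin := by
      refine ⟨Pi.single j 1, ?_⟩
      ext i
      simp
    rw [← heq] at hj
    obtain ⟨x, hx⟩ := hj
    exact ⟨x, by simpa using hx⟩
  choose x hx using hcol
  obtain ⟨X, hX⟩ : ∃ X : Matrix ι n K, A.submatrix id c * X = A :=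
    ⟨Matrix.of fun k j => x j k, by
      ext i j
      simpa [Matrix.mul_apply, Matrix.mulVec, dotProduct] using congr_fun (hx j) i⟩
  -- restricting `A = C X` to the pivot rows gives `R = P X`, so `X = P⁻¹ R` and `Ã = C X = A`.
  have hPX : A.submatrix r c * X = A.submatrix r id := by
    have h := congr_arg (fun M : Matrix m n K => M.submatrix r id) hX
    rw [Matrix.submatrix_mul _ _ r id id Function.bijective_id] at h
    simpa only [Matrix.submatrix_submatrix, Matrix.submatrix_id_id, Function.comp_id,
      Function.id_comp] using h
  have hXeq : X = (A.submatrix r c)⁻¹ * A.submatrix r id := by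
    rw [← hPX, Matrix.nonsing_inv_mul_cancel_left _ _ hP]
  calc crossInterp A r c = A.submatrix id c * ((A.submatrix r c)⁻¹ * A.submatrix r id) :=
      Matrix.mul_assoc _ _ _
    _ = A := by rw [← hXeq, hX]

/-- The cross interpolation on a nonsingular pivot matrix is exact if and only if the number of
pivots equals the rank.
[cite: NunezFernandezEtAl2025, §3.1 properties (i)–(ii)][cite: HornJohnson2013, §0.8.5 (b)] -/
theorem crossInterp_eq_self_iff_rank_eq (A : Matrix m n K) {r : ι → m} {c : ι → n}
    (hP : IsUnit (A.submatrix r c).det) :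
    crossInterp A r c = A ↔ A.rank = Fintype.card ι := by
  refine ⟨fun h => le_antisymm ?_ (card_le_rank_of_isUnit_det_submatrix A hP),
    crossInterp_eq_self_of_rank_eq A hP⟩
  calc A.rank = (crossInterp A r c).rank := by rw [h]
    _ ≤ Fintype.card ι := rank_crossInterp_le A r c

/-- Block form of the exactness criterion: for nonsingular `A₁₁ : Matrix ι ι K`,
`rank [[A₁₁, A₁₂], [A₂₁, A₂₂]] = card ι` if and only if `A₂₂ = A₂₁ A₁₁⁻¹ A₁₂` (the Schur
complement vanishes).
[cite: HornJohnson2013, §0.8.5 (b)] -/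
theorem rank_fromBlocks_eq_card_iff {m' n' : Type*} [Fintype n'] (A₁₁ : Matrix ι ι K)
    (A₁₂ : Matrix ι n' K) (A₂₁ : Matrix m' ι K) (A₂₂ : Matrix m' n' K) (h : IsUnit A₁₁.det) :
    (fromBlocks A₁₁ A₁₂ A₂₁ A₂₂).rank = Fintype.card ι ↔ A₂₂ = A₂₁ * A₁₁⁻¹ * A₁₂ := by
  have hP : IsUnit ((fromBlocks A₁₁ A₁₂ A₂₁ A₂₂).submatrix Sum.inl Sum.inl).det := by
    rwa [fromBlocks_submatrix_inl_inl]
  rw [← crossInterp_eq_self_iff_rank_eq _ hP, crossInterp_fromBlocks _ _ _ _ h,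
    Matrix.fromBlocks_inj]
  constructor
  · rintro ⟨-, -, -, h4⟩
    exact h4.symm
  · intro h4
    exact ⟨rfl, rfl, rfl, h4.symm⟩

/-! ### Guttman rank additivity -/

/-- The rank of a block-diagonal matrix whose leading block is nonsingular (helper for
`rank_fromBlocks_eq_card_add_rank_schur`, of which it is the case `A₁₂ = 0`, `A₂₁ = 0`).
[folklore] -/
private theorem rank_fromBlocks_zero₁₂_zero₂₁_of_isUnit_det {m' n' : Type*} [Fintype m']
    [Fintype n'] (A₁₁ : Matrix ι ι K) (S : Matrix m' n' K) (h : IsUnit A₁₁.det) :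
    (fromBlocks A₁₁ 0 0 S).rank = Fintype.card ι + S.rank := by
  -- under `K^(ι ⊕ m') ≃ K^ι × K^m'`, `range [[A₁₁, 0], [0, S]] = K^ι × range S`
  let e : (ι ⊕ m' → K) ≃ₗ[K] (ι → K) × (m' → K) := LinearEquiv.sumArrowLequivProdArrow ι m' K K
  have hrange : (LinearMap.range (fromBlocks A₁₁ 0 0 S).mulVecLin).map (e : _ →ₗ[K] _) =
      (⊤ : Submodule K (ι → K)).prod (LinearMap.range S.mulVecLin) := by
    apply le_antisymm
    · rintro _ ⟨_, ⟨v, rfl⟩, rfl⟩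
      refine ⟨trivial, ⟨v ∘ Sum.inr, ?_⟩⟩
      ext i
      simp [e, Matrix.fromBlocks_mulVec]
    · rintro ⟨u, w⟩ ⟨-, ⟨v, rfl⟩⟩
      refine ⟨_, ⟨Sum.elim (A₁₁⁻¹ *ᵥ u) v, rfl⟩, ?_⟩
      ext i
      · simp [e, Matrix.fromBlocks_mulVec, Matrix.mulVec_mulVec, Matrix.mul_nonsing_inv _ h]
      · simp [e, Matrix.fromBlocks_mulVec]
  have hfin := LinearEquiv.finrank_map_eq e (LinearMap.range (fromBlocks A₁₁ 0 0 S).mulVecLin)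
  rw [hrange] at hfin
  -- `finrank (K^ι × range S) = card ι + rank S`
  let f : ((⊤ : Submodule K (ι → K)).prod (LinearMap.range S.mulVecLin)) ≃ₗ[K]
      (ι → K) × LinearMap.range S.mulVecLin :=
    { toFun := fun x => (x.1.1, ⟨x.1.2, x.2.2⟩)
      invFun := fun y => ⟨(y.1, (y.2 : m' → K)), ⟨trivial, y.2.2⟩⟩
      map_add' := fun _ _ => rfl
      map_smul' := fun _ _ => rfl
      left_inv := fun _ => rfl
      right_inv := fun _ => rfl }
  rw [f.finrank_eq, Module.finrank_prod, Module.finrank_pi K] at hfin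
  unfold Matrix.rank
  exact hfin.symm

/-- GUTTMAN RANK ADDITIVITY: for a block matrix `A = [[A₁₁, A₁₂], [A₂₁, A₂₂]]` with nonsingular
leading block `A₁₁ : Matrix ι ι K`, `rank A = card ι + rank [A/A₁₁]` where
`[A/A₁₁] = A₂₂ - A₂₁ A₁₁⁻¹ A₁₂` is the Schur complement — i.e. the rank of `A` is the number of
pivots plus the rank of the cross-interpolation error.
[cite: HornJohnson2013, §0.8.5 (b)] -/
theorem rank_fromBlocks_eq_card_add_rank_schur {m' n' : Type*} [Fintype m'] [Fintype n']
    (A₁₁ : Matrix ι ι K) (A₁₂ : Matrix ι n' K) (A₂₁ : Matrix m' ι K) (A₂₂ : Matrix m' n' K)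
    (h : IsUnit A₁₁.det) :
    (fromBlocks A₁₁ A₁₂ A₂₁ A₂₂).rank = Fintype.card ι + (A₂₂ - A₂₁ * A₁₁⁻¹ * A₁₂).rank := by
  classical
  letI : Invertible A₁₁ := Matrix.invertibleOfIsUnitDet A₁₁ h
  -- `A = L [[A₁₁, 0], [0, [A/A₁₁]]] U` with `L`, `U` unitriangular (Mathlib's block LDU)
  rw [Matrix.fromBlocks_eq_of_invertible₁₁ A₁₁ A₁₂ A₂₁ A₂₂, Matrix.invOf_eq_nonsing_inv,
    Matrix.rank_mul_eq_left_of_isUnit_det _ _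
      (by rw [Matrix.det_fromBlocks_zero₂₁, Matrix.det_one, Matrix.det_one, one_mul]
          exact isUnit_one),
    Matrix.rank_mul_eq_right_of_isUnit_det _ _
      (by rw [Matrix.det_fromBlocks_zero₁₂, Matrix.det_one, Matrix.det_one, one_mul]
          exact isUnit_one),
    rank_fromBlocks_zero₁₂_zero₂₁_of_isUnit_det _ _ h]

end Field

end Literature.LinearAlgebra.Matrix
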